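import Mathlib
import HarnessLib
import Summits.NavierStokesRegularity.NavierStokesRegularity.Theorems.TaylorModelRungThreeVReadoutsDefs
import Summits.NavierStokesRegularity.NavierStokesRegularity.Theorems.TaylorModelRungThreeVRadiiStep
import Summits.NavierStokesRegularity.NavierStokesRegularity.Theorems.TaylorModelRungThreeReadoutVNodesDeriv
import Summits.NavierStokesRegularity.NavierStokesRegularity.Theorems.TaylorModelRungThreeReadoutVLandTools

/-!
# Line `taylor-model` on crux K1b-DR (stmt-NavierStokesRegularity-23954) — v3 read-outs (R2)/(R3): the TUBE-GROWTH
# semantics of kernel chains, reduced to per-step VECTOR PROPAGATION and PRODUCTS (G-side toolkit for the growth table `G`)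

Clause (R2) of `ReadoutsV` asks, for every pair of nodes `s₀ ≤ s₁ ≤ S` of a stage, that every chain of real one-step kernels
`A s' ∈ [Mlo s', Mhi s']` (`s₀ ≤ s' < s₁`) maps the `r·ω`-ball into the `G s₀ s₁ · r·ω`-ball under the iterated action `kiter`.
This file reduces that semantic clause to what a checker computes:

* `kiter_add` — `kiter A s₀ (m + n) = kiter A (s₀ + m) n ∘ kiter A s₀ m` (chains compose);
* `absLeW_kapp_of_abs_le` — ONE STEP: an entrywise kernel majorant `|A| ≤ N` propagates a componentwise bound `|v| ≤ b` to
  `|kapp A v|_{(i',k')} ≤ Σ_c N_{(i',k'),c} · b_c` (abs row sums through the window enumeration);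
* `abs_le_max_of_kerMem` — the majorant a kernel interval supplies: `A ∈ [lo, hi] ⇒ |A| ≤ max |lo| |hi|`;
* `absLeW_kiter` — n STEPS: any sequence of bound vectors `g m` with `Σ_c N_{s₀+m} · g m ≤ g (m+1)` dominates the chain;
* `inBall_kiter_of_propagation` — the (R2) GROWTH FACTOR of one block from the propagated weight vector: start `g 0 ≥ ω`,
  finish `g n ≤ G·ω` ⇒ the `r·ω`-ball goes to the `G·r·ω`-ball (the nonnegative product `|M_{s₁−1}|⋯|M_{s₀}|` attains its
  ω-weighted operator norm at the vector `ω`, so propagating ω IS the sharp block factor);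
* `growth_refl`, `growth_mono`, `growth_trans` — the block factors compose SUBMULTIPLICATIVELY (`G(s₀,s₂) := G(s₁,s₂)·G(s₀,s₁)`),
  so a checker may certify (R2) for all `O(S²)` pairs from `O(S)` propagated blocks and products;
* `kerOf_kiter_succ`, `kiter_eq_kapp_kerOf` — the chain as ONE product kernel `kerOf (kiter A s₀ n)` with the recursion
  `kcomp (A (s₀+n)) (kerOf (kiter A s₀ n))` (the shape an interval matrix product encloses factor by factor — sign cancellation
  retained inside a block, PROPAGATE-V-SPEC-cert1 §10);
* `absLeW_kiter_of_prodMem`, `inBall_kiter_of_prodMem` (§10 (i): within-block pairs), `inBall_kiter_split` (§10 (ii): ONE split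
  at a block boundary `B`, suffix product reduced to the vector `u = |Q(B←a)|·ω`, forward product `|P(b←B)|·u ≤ G·ω`).

Pure bookkeeping over `kiter`/`kapp`/`KerMem`/`InBall`; MODEL-lattice rung TL-M3 only; nothing here is a statement about the
Navier–Stokes equations, and nothing about the certificate is asserted.
-/

noncomputable section

-- the sub-problem namespace repeats the summit name by design (D-0017)
set_option linter.dupNamespace false

namespace Summit.NavierStokesRegularity.NavierStokesRegularity.Theorems.TaylorModelV

open scoped BigOperators
open Set Finset
open Literature.Analysis.FluidPDE.TaoCascade Literature.Analysis.FluidPDE.TaoCascade.TaylorChain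
open Summit.NavierStokesRegularity.NavierStokesRegularity.Theorems.TaylorModelReadout

variable {cd : CertData}

/-! ### Chains compose -/

/-- `kiter A s₀ (m + n) v = kiter A (s₀ + m) n (kiter A s₀ m v)`. [folklore] -/
theorem kiter_add (A : ℕ → Ker) (s₀ m : ℕ) : ∀ (n : ℕ) (v : Fin 4 → ℤ → ℝ),
    kiter cd A s₀ (m + n) v = kiter cd A (s₀ + m) n (kiter cd A s₀ m v)
  | 0, _ => rfl
  | n + 1, v => by
    show kapp cd (A (s₀ + (m + n))) (kiter cd A s₀ (m + n) v) = kapp cd (A (s₀ + m + n)) (kiter cd A (s₀ + m) n _)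
    rw [kiter_add A s₀ m n v, Nat.add_assoc]

/-- `kiter A s₀ 1 = kapp (A s₀)`. [folklore] -/
theorem kiter_one (A : ℕ → Ker) (s₀ : ℕ) (v : Fin 4 → ℤ → ℝ) : kiter cd A s₀ 1 v = kapp cd (A s₀) v := by
  show kapp cd (A (s₀ + 0)) v = _; rw [Nat.add_zero]

/-! ### One step: abs row sums -/

/-- The entrywise majorant of a kernel interval: `A ∈ [lo, hi]` on the window gives `|A| ≤ max |lo| |hi|` there. [folklore] -/
theorem abs_le_max_of_kerMem {A lo hi : Ker} (hA : KerMem cd A lo hi) (i' : Fin 4) {k' : ℤ} (hk1' : -cd.Kb ≤ k')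
    (hk2' : k' ≤ cd.Ka) (i : Fin 4) {k : ℤ} (hk1 : -cd.Kb ≤ k) (hk2 : k ≤ cd.Ka) :
    |A i' k' i k| ≤ max |lo i' k' i k| |hi i' k' i k| := by
  obtain ⟨h1, h2⟩ := hA i' k' hk1' hk2' i k hk1 hk2
  rcases le_or_gt 0 (A i' k' i k) with h | h
  · exact le_max_of_le_right (by rw [abs_of_nonneg h]; exact h2.trans (le_abs_self _))
  · exact le_max_of_le_left (by rw [abs_of_neg h]; exact (neg_le_neg h1).trans (neg_le_abs _))

/-- **ONE STEP.** An entrywise majorant `N` of the kernel on the window (`|A_{(i',k'),(i,k)}| ≤ N_{(i',k'),(i,k)}`) propagates a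
componentwise bound `|v| ≤ b` (window) to `|kapp A v|_{(i',k')} ≤ Σ_c N_{(i',k'),c}·b_c`. [folklore] -/
theorem absLeW_kapp_of_abs_le {A N : Ker}
    (hA : ∀ i' k', -cd.Kb ≤ k' → k' ≤ cd.Ka → ∀ i k, -cd.Kb ≤ k → k ≤ cd.Ka → |A i' k' i k| ≤ N i' k' i k)
    {v b : Fin 4 → ℤ → ℝ} (hv : AbsLeW cd v b) :
    AbsLeW cd (kapp cd A v)
      (fun i' k' => ∑ c : Fin (nW cd), N i' k' (modeOf cd c) (shellOf cd c) * b (modeOf cd c) (shellOf cd c)) := by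
  intro i' k' hk1' hk2'
  rw [kapp_apply_of_InW A v i' ⟨hk1', hk2'⟩]
  refine (Finset.abs_sum_le_sum_abs _ _).trans (Finset.sum_le_sum fun c _ => ?_)
  have hc := shellOf_mem cd c
  rw [abs_mul]
  exact mul_le_mul (hA i' k' hk1' hk2' _ _ hc.1 hc.2) (hv _ _ hc.1 hc.2) (abs_nonneg _)
    ((abs_nonneg _).trans (hA i' k' hk1' hk2' _ _ hc.1 hc.2))

/-! ### n steps: propagated bound vectors -/

/-- **n STEPS.** If `N (s₀+m)` majorises `A (s₀+m)` entrywise on the window for `m < n`, and the bound vectors `g` satisfy the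
propagation inequalities `Σ_c N_{s₀+m,(i',k'),c} · g m c ≤ g (m+1) (i',k')` on the window, then `|v| ≤ g 0 ⇒ |kiter A s₀ n v| ≤ g n`.
[folklore] -/
theorem absLeW_kiter (A N : ℕ → Ker) (s₀ : ℕ) (g : ℕ → Fin 4 → ℤ → ℝ) :
    ∀ (n : ℕ), (∀ m, m < n → ∀ i' k', -cd.Kb ≤ k' → k' ≤ cd.Ka → ∀ i k, -cd.Kb ≤ k → k ≤ cd.Ka →
        |A (s₀ + m) i' k' i k| ≤ N (s₀ + m) i' k' i k) →
      (∀ m, m < n → ∀ i' k', -cd.Kb ≤ k' → k' ≤ cd.Ka →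
        ∑ c : Fin (nW cd), N (s₀ + m) i' k' (modeOf cd c) (shellOf cd c) * g m (modeOf cd c) (shellOf cd c) ≤
          g (m + 1) i' k') →
      ∀ v : Fin 4 → ℤ → ℝ, AbsLeW cd v (g 0) → AbsLeW cd (kiter cd A s₀ n v) (g n)
  | 0, _, _, _, hv => hv
  | n + 1, hA, hg, v, hv => by
    have ih := absLeW_kiter A N s₀ g n (fun m hm => hA m (Nat.lt_succ_of_lt hm)) (fun m hm => hg m (Nat.lt_succ_of_lt hm)) v hv
    intro i' k' hk1' hk2'
    exact (absLeW_kapp_of_abs_le (hA n (Nat.lt_succ_self n)) ih i' k' hk1' hk2').trans (hg n (Nat.lt_succ_self n) i' k' hk1' hk2')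

/-- **THE (R2) GROWTH FACTOR OF ONE BLOCK from vector propagation.** Kernels `A s' ∈ [Mlo s', Mhi s']` for `s₀ ≤ s' < s₀ + n`;
bound vectors `g` with `ω_j ≤ g 0`, the propagation inequalities for the interval majorants `max |Mlo| |Mhi|`, and `g n ≤ G·ω_j`
(window components): then the `r·ω_j`-ball is mapped into the `G·r·ω_j`-ball by `kiter A s₀ n` (`0 ≤ r`). [folklore] -/
theorem inBall_kiter_of_propagation {j : ℕ} {Mlo Mhi : ℕ → Ker} {A : ℕ → Ker} {s₀ n : ℕ}
    (hA : ∀ s', s₀ ≤ s' → s' < s₀ + n → KerMem cd (A s') (Mlo s') (Mhi s'))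
    (g : ℕ → Fin 4 → ℤ → ℝ) (hg0 : ∀ i k, -cd.Kb ≤ k → k ≤ cd.Ka → cd.ω j k ≤ g 0 i k)
    (hg : ∀ m, m < n → ∀ i' k', -cd.Kb ≤ k' → k' ≤ cd.Ka →
      ∑ c : Fin (nW cd), max |Mlo (s₀ + m) i' k' (modeOf cd c) (shellOf cd c)| |Mhi (s₀ + m) i' k' (modeOf cd c) (shellOf cd c)| *
          g m (modeOf cd c) (shellOf cd c) ≤ g (m + 1) i' k')
    {G : ℝ} (hG : ∀ i k, -cd.Kb ≤ k → k ≤ cd.Ka → g n i k ≤ G * cd.ω j k)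
    {v : Fin 4 → ℤ → ℝ} {r : ℝ} (hr : 0 ≤ r) (hv : cd.InBall j v r) :
    cd.InBall j (kiter cd A s₀ n v) (G * r) := by
  -- propagate the scaled bound vectors `r • g m`
  have key := absLeW_kiter (cd := cd) A (fun s' i' k' i k => max |Mlo s' i' k' i k| |Mhi s' i' k' i k|) s₀
    (fun m i k => r * g m i k) n
    (fun m hm i' k' hk1' hk2' i k hk1 hk2 => abs_le_max_of_kerMem (hA _ (Nat.le_add_right _ _) (by omega)) i' hk1' hk2' i hk1 hk2)
    (fun m hm i' k' hk1' hk2' => by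
      have e : ∑ c : Fin (nW cd), max |Mlo (s₀ + m) i' k' (modeOf cd c) (shellOf cd c)|
            |Mhi (s₀ + m) i' k' (modeOf cd c) (shellOf cd c)| * (r * g m (modeOf cd c) (shellOf cd c)) =
          r * ∑ c : Fin (nW cd), max |Mlo (s₀ + m) i' k' (modeOf cd c) (shellOf cd c)|
            |Mhi (s₀ + m) i' k' (modeOf cd c) (shellOf cd c)| * g m (modeOf cd c) (shellOf cd c) := by
        rw [Finset.mul_sum]; exact Finset.sum_congr rfl fun c _ => by ring
      rw [e]; exact mul_le_mul_of_nonneg_left (hg m hm i' k' hk1' hk2') hr)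
    v (fun i k hk1 hk2 => (hv i k hk1 hk2).trans (mul_le_mul_of_nonneg_left (hg0 i k hk1 hk2) hr))
  intro i k hk1 hk2
  calc |kiter cd A s₀ n v i k| ≤ r * g n i k := key i k hk1 hk2
    _ ≤ r * (G * cd.ω j k) := mul_le_mul_of_nonneg_left (hG i k hk1 hk2) hr
    _ = G * r * cd.ω j k := by ring

/-! ### Block factors compose: the growth relation is reflexive, monotone and submultiplicative -/

/-- Length-zero chains do not move: factor `1`. [folklore] -/
theorem growth_refl (j s₀ : ℕ) (A : ℕ → Ker) (v : Fin 4 → ℤ → ℝ) (r : ℝ) (hv : cd.InBall j v r) :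
    cd.InBall j (kiter cd A s₀ 0 v) (1 * r) := by
  rw [one_mul]; exact hv

/-- A larger factor is still a factor (weights `ω_j ≥ 0`, radius `r ≥ 0`). [folklore] -/
theorem growth_mono {j : ℕ} (hω : ∀ k, 0 ≤ cd.ω j k) {G G' r : ℝ} (hGG' : G ≤ G') (hr : 0 ≤ r) {w : Fin 4 → ℤ → ℝ}
    (hw : cd.InBall j w (G * r)) : cd.InBall j w (G' * r) := fun i k hk1 hk2 =>
  (hw i k hk1 hk2).trans (mul_le_mul_of_nonneg_right (mul_le_mul_of_nonneg_right hGG' hr) (hω k))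

/-- **SUBMULTIPLICATIVITY.** If every admissible chain over `[s₀, s₀+m)` grows balls by at most `G₁ ≥ 0` and every admissible
chain over `[s₀+m, s₀+m+n)` by at most `G₂`, then every admissible chain over `[s₀, s₀+m+n)` grows balls by at most `G₂·G₁`.
(«Admissible» = kernels in the given intervals; the hypothesis sets may differ per block.) [folklore] -/
theorem growth_trans {j : ℕ} {P : ℕ → Ker → Prop} {s₀ m n : ℕ} {G₁ G₂ : ℝ} (hG₁ : 0 ≤ G₁)
    (h₁ : ∀ A : ℕ → Ker, (∀ s', s₀ ≤ s' → s' < s₀ + m → P s' (A s')) →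
      ∀ (v : Fin 4 → ℤ → ℝ) (r : ℝ), 0 ≤ r → cd.InBall j v r → cd.InBall j (kiter cd A s₀ m v) (G₁ * r))
    (h₂ : ∀ A : ℕ → Ker, (∀ s', s₀ + m ≤ s' → s' < s₀ + m + n → P s' (A s')) →
      ∀ (v : Fin 4 → ℤ → ℝ) (r : ℝ), 0 ≤ r → cd.InBall j v r → cd.InBall j (kiter cd A (s₀ + m) n v) (G₂ * r))
    (A : ℕ → Ker) (hA : ∀ s', s₀ ≤ s' → s' < s₀ + (m + n) → P s' (A s')) (v : Fin 4 → ℤ → ℝ) (r : ℝ) (hr : 0 ≤ r)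
    (hv : cd.InBall j v r) : cd.InBall j (kiter cd A s₀ (m + n) v) (G₂ * G₁ * r) := by
  rw [kiter_add, mul_assoc]
  exact h₂ A (fun s' h1 h2 => hA s' (by omega) (by omega)) _ _ (mul_nonneg hG₁ hr)
    (h₁ A (fun s' h1 h2 => hA s' h1 (by omega)) v r hr hv)

/-- **(R2) for ONE PAIR `s₀ ≤ s₁` from a block factor**, in the literal shape of `ReadoutsV` (R2) (`kiter … (s₁ − s₀)`):
a restatement helper turning a factor for `n := s₁ − s₀` steps into the clause instance. [folklore] -/
theorem growth_pair {j : ℕ} {Mlo Mhi : ℕ → Ker} {s₀ s₁ : ℕ} (hs : s₀ ≤ s₁) {G : ℝ}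
    (h : ∀ A : ℕ → Ker, (∀ s', s₀ ≤ s' → s' < s₀ + (s₁ - s₀) → KerMem cd (A s') (Mlo s') (Mhi s')) →
      ∀ (v : Fin 4 → ℤ → ℝ) (r : ℝ), 0 ≤ r → cd.InBall j v r → cd.InBall j (kiter cd A s₀ (s₁ - s₀) v) (G * r))
    (A : ℕ → Ker) (hA : ∀ s', s₀ ≤ s' → s' < s₁ → KerMem cd (A s') (Mlo s') (Mhi s')) (v : Fin 4 → ℤ → ℝ) (r : ℝ)
    (hr : 0 ≤ r) (hv : cd.InBall j v r) : cd.InBall j (kiter cd A s₀ (s₁ - s₀) v) (G * r) :=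
  h A (fun s' h1 h2 => hA s' h1 (by omega)) v r hr hv

/-! ### The product kernel `kerOf (kiter A s₀ n)`: chains as ONE kernel (sign cancellation retained inside a block) -/

/-- `kiter` only reads the window values of its argument (window rows; all rows for `n ≥ 1`). [folklore] -/
theorem kiter_congr_window (A : ℕ → Ker) (s₀ : ℕ) {v w : Fin 4 → ℤ → ℝ}
    (h : ∀ i k, -cd.Kb ≤ k → k ≤ cd.Ka → v i k = w i k) :
    ∀ (n : ℕ) (i : Fin 4) (k : ℤ), -cd.Kb ≤ k → k ≤ cd.Ka → kiter cd A s₀ n v i k = kiter cd A s₀ n w i k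
  | 0, i, k, hk1, hk2 => h i k hk1 hk2
  | n + 1, i, k, _, _ => by
    show kapp cd (A (s₀ + n)) (kiter cd A s₀ n v) i k = kapp cd (A (s₀ + n)) (kiter cd A s₀ n w) i k
    rw [kapp_congr (A (s₀ + n)) (kiter_congr_window A s₀ h n)]

/-- `kiter A s₀ n` is linear. [folklore] -/
theorem kiter_linear (A : ℕ → Ker) (s₀ : ℕ) : ∀ n : ℕ, IsLinearMap ℝ (kiter cd A s₀ n)
  | 0 => ⟨fun _ _ => rfl, fun _ _ => rfl⟩
  | n + 1 => by
    have ih := kiter_linear A s₀ n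
    have hk := kapp_linear (cd := cd) (A (s₀ + n))
    refine ⟨fun v w => ?_, fun r v => ?_⟩
    · show kapp cd (A (s₀ + n)) (kiter cd A s₀ n (v + w)) = _
      rw [ih.map_add, hk.map_add]; rfl
    · show kapp cd (A (s₀ + n)) (kiter cd A s₀ n (r • v)) = _
      rw [ih.map_smul, hk.map_smul]; rfl

/-- The product kernel of the empty chain is the identity kernel. [folklore] -/
theorem kerOf_kiter_zero (A : ℕ → Ker) (s₀ : ℕ) (i' : Fin 4) (k' : ℤ) (i : Fin 4) (k : ℤ) :
    kerOf (kiter cd A s₀ 0) i' k' i k = if i' = i ∧ k' = k then 1 else 0 := rfl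

/-- **Product recursion** (window rows): `kerOf (kiter A s₀ (n+1)) = kcomp (A (s₀+n)) (kerOf (kiter A s₀ n))` — the form in which an
interval matrix product `[M_{s₀+n}]·[Π]` encloses the real product, one factor at a time. [folklore] -/
theorem kerOf_kiter_succ (A : ℕ → Ker) (s₀ n : ℕ) (i' : Fin 4) {k' : ℤ} (hk1' : -cd.Kb ≤ k') (hk2' : k' ≤ cd.Ka)
    (i : Fin 4) (k : ℤ) :
    kerOf (kiter cd A s₀ (n + 1)) i' k' i k = kcomp cd (A (s₀ + n)) (kerOf (kiter cd A s₀ n)) i' k' i k := by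
  show kapp cd (A (s₀ + n)) (kiter cd A s₀ n (basisSt i k)) i' k' = _
  rw [kapp_apply_of_InW _ _ i' ⟨hk1', hk2'⟩]
  rfl

/-- **The chain IS its product kernel** (window rows): `kiter A s₀ n v = kapp (kerOf (kiter A s₀ n)) v`. [folklore] -/
theorem kiter_eq_kapp_kerOf (A : ℕ → Ker) (s₀ n : ℕ) (v : Fin 4 → ℤ → ℝ) (i' : Fin 4) {k' : ℤ} (hk1' : -cd.Kb ≤ k')
    (hk2' : k' ≤ cd.Ka) : kiter cd A s₀ n v i' k' = kapp cd (kerOf (kiter cd A s₀ n)) v i' k' := by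
  rw [kapp_congr (kerOf (kiter cd A s₀ n)) (w := trunc cd v) (fun i k hk1 hk2 => by rw [trunc_apply, if_pos ⟨hk1, hk2⟩]),
    kapp_kerOf (kiter_linear A s₀ n) (wsupp_trunc cd v) i' ⟨hk1', hk2'⟩]
  exact kiter_congr_window A s₀ (fun i k hk1 hk2 => by rw [trunc_apply, if_pos ⟨hk1, hk2⟩]) n i' k' hk1' hk2'

/-- **n steps through ONE kernel interval**: if the product kernel lies in `[Plo, Phi]` (window entries), then
`|v| ≤ b ⇒ |kiter A s₀ n v|_{(i',k')} ≤ Σ_c max |Plo| |Phi|_{(i',k'),c} · b_c`. [folklore] -/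
theorem absLeW_kiter_of_prodMem {A : ℕ → Ker} {s₀ n : ℕ} {Plo Phi : Ker} (hP : KerMem cd (kerOf (kiter cd A s₀ n)) Plo Phi)
    {v b : Fin 4 → ℤ → ℝ} (hv : AbsLeW cd v b) :
    AbsLeW cd (kiter cd A s₀ n v) (fun i' k' => ∑ c : Fin (nW cd),
      max |Plo i' k' (modeOf cd c) (shellOf cd c)| |Phi i' k' (modeOf cd c) (shellOf cd c)| * b (modeOf cd c) (shellOf cd c)) := by
  intro i' k' hk1' hk2'
  rw [kiter_eq_kapp_kerOf A s₀ n v i' hk1' hk2']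
  exact absLeW_kapp_of_abs_le (fun i' k' hk1' hk2' i k hk1 hk2 => abs_le_max_of_kerMem hP i' hk1' hk2' i hk1 hk2) hv i' k' hk1' hk2'

/-- **THE SPLIT-VECTOR BOUND** (PROPAGATE-V-SPEC §10 (ii), one split at `B`, `a ≤ B ≤ b`): with the product kernel of the chain over
`[a, B)` in `[Qlo, Qhi]` and that over `[B, b)` in `[Plo, Phi]`, any vector `u ≥ max|Qlo||Qhi| · ω_j` and any `G` with
`max|Plo||Phi| · u ≤ G · ω_j` (window rows) give: the `r·ω_j`-ball is mapped into the `G·r·ω_j`-ball by `kiter A a (b − a)`. [folklore] -/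
theorem inBall_kiter_split {j : ℕ} {A : ℕ → Ker} {a B b : ℕ} (haB : a ≤ B) (hBb : B ≤ b) {Qlo Qhi Plo Phi : Ker}
    (hQ : KerMem cd (kerOf (kiter cd A a (B - a))) Qlo Qhi) (hP : KerMem cd (kerOf (kiter cd A B (b - B))) Plo Phi)
    (u : Fin 4 → ℤ → ℝ)
    (hu : ∀ i' k', -cd.Kb ≤ k' → k' ≤ cd.Ka → ∑ c : Fin (nW cd),
      max |Qlo i' k' (modeOf cd c) (shellOf cd c)| |Qhi i' k' (modeOf cd c) (shellOf cd c)| * cd.ω j (shellOf cd c) ≤ u i' k')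
    {G : ℝ} (hG : ∀ i' k', -cd.Kb ≤ k' → k' ≤ cd.Ka → ∑ c : Fin (nW cd),
      max |Plo i' k' (modeOf cd c) (shellOf cd c)| |Phi i' k' (modeOf cd c) (shellOf cd c)| * u (modeOf cd c) (shellOf cd c) ≤
        G * cd.ω j k')
    {v : Fin 4 → ℤ → ℝ} {r : ℝ} (hr : 0 ≤ r) (hv : cd.InBall j v r) :
    cd.InBall j (kiter cd A a (b - a) v) (G * r) := by
  have e : b - a = (B - a) + (b - B) := by omega
  have eB : a + (B - a) = B := by omega
  rw [e, kiter_add, eB]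
  -- first leg: `|kiter (B − a) v| ≤ r • u`
  have h1 : AbsLeW cd (kiter cd A a (B - a) v) (fun i k => r * u i k) := by
    intro i' k' hk1' hk2'
    refine (absLeW_kiter_of_prodMem hQ (b := fun i k => r * cd.ω j k) (fun i k hk1 hk2 => hv i k hk1 hk2) i' k' hk1' hk2').trans ?_
    have eq : ∑ c : Fin (nW cd), max |Qlo i' k' (modeOf cd c) (shellOf cd c)| |Qhi i' k' (modeOf cd c) (shellOf cd c)| *
          (r * cd.ω j (shellOf cd c)) =
        r * ∑ c : Fin (nW cd), max |Qlo i' k' (modeOf cd c) (shellOf cd c)| |Qhi i' k' (modeOf cd c) (shellOf cd c)| *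
          cd.ω j (shellOf cd c) := by
      rw [Finset.mul_sum]; exact Finset.sum_congr rfl fun c _ => by ring
    dsimp only
    rw [eq]; exact mul_le_mul_of_nonneg_left (hu i' k' hk1' hk2') hr
  -- second leg: `|kiter (b − B) w| ≤ r • (max|P| · u) ≤ G r ω`
  intro i' k' hk1' hk2'
  refine (absLeW_kiter_of_prodMem hP h1 i' k' hk1' hk2').trans ?_
  have eq : ∑ c : Fin (nW cd), max |Plo i' k' (modeOf cd c) (shellOf cd c)| |Phi i' k' (modeOf cd c) (shellOf cd c)| *
        (r * u (modeOf cd c) (shellOf cd c)) =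
      r * ∑ c : Fin (nW cd), max |Plo i' k' (modeOf cd c) (shellOf cd c)| |Phi i' k' (modeOf cd c) (shellOf cd c)| *
        u (modeOf cd c) (shellOf cd c) := by
    rw [Finset.mul_sum]; exact Finset.sum_congr rfl fun c _ => by ring
  dsimp only
  rw [eq]
  calc r * _ ≤ r * (G * cd.ω j k') := mul_le_mul_of_nonneg_left (hG i' k' hk1' hk2') hr
    _ = G * r * cd.ω j k' := by ring

/-- **WITHIN-BLOCK PAIR** (§10 (i)): with the product kernel of the chain over `[a, b)` in `[Plo, Phi]` and
`max|Plo||Phi| · ω_j ≤ G · ω_j` (window rows), the `r·ω_j`-ball goes to the `G·r·ω_j`-ball. [folklore] -/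
theorem inBall_kiter_of_prodMem {j : ℕ} {A : ℕ → Ker} {a n : ℕ} {Plo Phi : Ker}
    (hP : KerMem cd (kerOf (kiter cd A a n)) Plo Phi) {G : ℝ}
    (hG : ∀ i' k', -cd.Kb ≤ k' → k' ≤ cd.Ka → ∑ c : Fin (nW cd),
      max |Plo i' k' (modeOf cd c) (shellOf cd c)| |Phi i' k' (modeOf cd c) (shellOf cd c)| * cd.ω j (shellOf cd c) ≤ G * cd.ω j k')
    {v : Fin 4 → ℤ → ℝ} {r : ℝ} (hr : 0 ≤ r) (hv : cd.InBall j v r) :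
    cd.InBall j (kiter cd A a n v) (G * r) := by
  intro i' k' hk1' hk2'
  refine (absLeW_kiter_of_prodMem hP (b := fun i k => r * cd.ω j k) (fun i k hk1 hk2 => hv i k hk1 hk2) i' k' hk1' hk2').trans ?_
  have eq : ∑ c : Fin (nW cd), max |Plo i' k' (modeOf cd c) (shellOf cd c)| |Phi i' k' (modeOf cd c) (shellOf cd c)| *
        (r * cd.ω j (shellOf cd c)) =
      r * ∑ c : Fin (nW cd), max |Plo i' k' (modeOf cd c) (shellOf cd c)| |Phi i' k' (modeOf cd c) (shellOf cd c)| *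
        cd.ω j (shellOf cd c) := by
    rw [Finset.mul_sum]; exact Finset.sum_congr rfl fun c _ => by ring
  dsimp only
  rw [eq]
  calc r * _ ≤ r * (G * cd.ω j k') := mul_le_mul_of_nonneg_left (hG i' k' hk1' hk2') hr
    _ = G * r * cd.ω j k' := by ring

end Summit.NavierStokesRegularity.NavierStokesRegularity.Theorems.TaylorModelV

end
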